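import Literature.Computability.Complexity.MurrayWilliams2018EasyWitnessAssembly
import Literature.Computability.Complexity.CircuitClassesUniformProofs
import HarnessLib

/-!
# Murray–Williams 2018, Lemma 4.1 (a.e. form) from its two quoted ingredients and the running
# time of the simulation: the assembly of the printed proof (§4, ECCC TR17-188 pp. 13–14)

This file PROVES the Easy Witness Lemma for low nondeterministic time in its almost-everywhere
form — the named fact `MurrayWilliams2018_lemma_4_1_ae` of `MurrayWilliams2018EasyWitness.lean`
— CONDITIONALLY on three explicitly stated hypotheses (theorem
`MurrayWilliams2018_lemma_4_1_ae_of_thm_3_1_of_thm_2_1_of_sim`), following the printed proof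
line by line:

1. **`h31` — Thm. 3.1 of the source** ("almost" an almost-everywhere circuit lower bound for `MA`
   with advice) over the tree: universal constants `d₁ d₂ d₃ K`; for every circuit-size function
   `σ` (strictly increasing, time constructible, `2n·σ(n) < 2ⁿ` for large `n`) and
   time-constructible `σ₁`, `σ₂` with (i) `σ(n)^{2d₂} ≤ σ₂(n)`, (ii) `σ(σ₂(n)) ≤ σ₁(n)`,
   (iii) `σ(n)^{2d₁+1} ≤ σ₁(n)`, a language `L₁`, a predicate `Ref ∈ DTIME(n^K)` of Arthur and
   advice strings `adv n` of length `≤ 2 log₂ σ₂(n) + 2` such that the two-move Merlin–Arthur game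
   with moves of length `mv(n) = σ₁(n)²·σ₂(n)^{d₃}` ("computable by a Merlin–Arthur protocol in
   `O(s₁(n)²·s₂(n)^{d₃})` time with `2 log s₂(n)` advice") satisfies the MA promise on every
   input with the language `L₁` (Def. 2.1, read on the nested pair words `⟨⟨⟨x, α⟩, z⟩, r⟩` through
   `Pr_r`; the convention of `MurrayWilliams2018Simulation.lean`), and for all large `n`,
   `σ(n) < cs(L₁, n)` or `σ(σ₂(n)) < cs(L₁, σ₂(n))`. The exponent `K` of Arthur's running time is
   UNIVERSAL (the printed time bound `O(s₁² s₂^{d₃})` has universal exponents; only the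
   `O`-constant depends on the protocol) — this is what allows the constant `g` of Lemma 4.1 to be
   chosen before `s` (Arthur's predicate is then a circuit of size `poly(mv)` of universal degree,
   `exists_arthur_circuits`, by the tableau simulation `FinTM2.exists_cktSize_sim`).
2. **`h21` — Thm. 2.1 of the source = Umans 2003, Thm. 6** (pseudo-random generators for all
   hardnesses) over the tree's `tableGenerator`/`IsSizePseudorandom` (`HardnessVsRandomness.lean`):
   a universal `g ≥ 1` and `F ∈ FP` such that for every table scale `m`, output length `u ≥ 1`
   and `f : {0,1}^m → {0,1}` with `u^g ≤ circuitSizeOver B2 f`, the generator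
   `σ ↦ F⟨tt f, ⟨1ᵘ, σ⟩⟩ ↾ u` on seeds of length `g·m` (= `g log |Y|`) is `SIZE(u)`-pseudorandom.
3. **`hN` — the running time of the simulation `N`** of p. 14 ("In total, `N` takes time
   `O(… t(nᵢ)^{a+g} …)`"): for all `γ`, `K`, `F ∈ FP` there is an exponent `E` such that for every
   `Ref ∈ DTIME(n^K)`, constant `CNb`, time-constructible monotone `t` and `mv` with
   `mv ≤ t + C₀`, and every verifier `V`, the language `MWSim.simLang` (the behaviour `N` fixed in
   `MurrayWilliams2018Simulation.lean`, output length `Nb ℓ a = CNb (ℓ + a + mv ℓ + 2)^{2K+2} + 7`,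
   kept guess length `2 (c_V t N + c_V) + mv N + 2`) is in `NTIME (t · ^ E)` — a `TM2` machine
   construction (clocks, the truncating wrapper, an `FP` body enumerating the seeds), the sequel of
   this file; `E` depends on `γ`, `K`, `F` only.

Given these, the proof (`false_of_components` and the final theorem) is the printed one: with
`d' = 2d₂ + 2d₁ + d₃ + 3`, `e = max E (2d' + 12)`, `g = (K+1)·g_U + 1`, `d = 1`, suppose
`NTIME[t]` lacks witness circuits of size `w(n) = s₂(s₂(s₂(n)))^{2g}`; take the verifier `V`
with bad inputs at infinitely many lengths (`exists_verifier_bad_prefix`, prefix form of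
`¬ HasWitnessCircuits`); apply `h31` to `s'(n) = s(e·n)`, `s₂' = s'^{d'}`, `s₁' = s' ∘ s₂'`
(time constructible by `TimeConstructibleClosure.lean`; a circuit-size function by proviso (a),
`eventually_two_mul_mul_stretchBase_lt`; constraints (i)–(iii) by arithmetic); the simulation
language of `(V, Ref, F)` is in `NTIME (t · ^ e)` (`hN`, `NTIME_pow_mono`), hence by the
hypothesis of the lemma has `s(N)`-size circuits at all large lengths `N`; on the two lengths
`ℓ ∈ {nᵢ, s₂'(nᵢ)}` and with the advice `βℓ = ⟨x_hard, adv ℓ⟩` the simulation decides `L₁`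
(`MWSim.mem_simLang_of_accepted` / `not_mem_simLang_of_rejected`: the tables are hard by
`MWSim.hard_tables_of_bad`, the generator fools Arthur's circuits since
`Nb^{g_U} ≤ w(nᵢ)`, `exists_arthur_circuits`), so hard-wiring `βℓ`
(`MWSim.circuitSize_le_of_slice_agree`) gives `cs(L₁, ℓ) ≤ s(2ℓ + |βℓ| + 2) + 2 ≤ s(e·ℓ) = s'(ℓ)`
at both lengths — contradicting Thm. 3.1 at `nᵢ` ("For `e ≥ 2d + 2`, this contradicts the
circuit lower bound of Theorem 3.1").

Relation to the parallel conditional assembly `MurrayWilliams2018_lemma_4_1_ae_of_ingredients`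
(`MurrayWilliams2018EasyWitnessAssembly.lean`, hypotheses `h31`, `hsim`): there `hsim` bundles the
whole derandomised advice simulation — Umans' generator AND the machine `N` — into one hypothesis
and `h31` fixes ONE referee in `P` before `s`; here the simulation is split into `h21` (Umans'
generator alone) and `hN` (the running time of the concrete behaviour `MWSim.simLang`, a pure
machine statement, discharged in `MurrayWilliams2018SimMachine.lean`), and `h31` lets the referee
depend on `s` but with a universal time EXPONENT `K` (Arthur's predicate in `DTIME(nᴷ)`), which is
all §4 needs. The arithmetic helpers `add_le_apply_add_of_strictMono`, `pow_le_pow_right_of_one_le`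
and the growth of `stretch` are taken from that file and from
`MurrayWilliams2018EasyWitnessRegimes.lean`.

Hypothesis (b) of the lemma is used with `d = 1` only (`mv ℓ ≤ s₂'(s₂'(ℓ)) ≤ s₂³(ℓ) ≤ t(ℓ)`
eventually: the machine measures its time at its own input length `≥ ℓ`, so no comparison
`t(nᵢ)` vs `t(s₂'(nᵢ))` beyond monotonicity is needed). Theorems only; the three hypotheses are
binders of the final theorem, not named facts (D-0026).

## References

* C. D. Murray, R. R. Williams, *Circuit lower bounds for nondeterministic quasi-polytime: an easy
  witness lemma for NP and NQP*, STOC 2018 (ECCC TR17-188), Thm. 2.1, Def. 2.1, Thm. 3.1, Lemma 4.1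
  and its proof (pp. 13–14) [MurrayWilliams2018].
* C. Umans, *Pseudo-random generators for all hardnesses*, J. Comput. Syst. Sci. 67 (2003)
  419–440, Thm. 6 [Umans2003].
* S. Arora, B. Barak, *Computational Complexity: A Modern Approach*, CUP 2009, Thm. 6.6
  (`DTIME(T) ⊆ SIZE(O(T²))`, tableau) [AroraBarak2009].
-/

noncomputable section

namespace Literature.Computability.Complexity

open _root_.Computability Finset Filter MetaComplexity Turing

namespace MWSim

/-! ### Bad inputs in the prefix form -/

/-- **Bad inputs, prefix form** (Murray–Williams, proof of Lemma 4.1, (4.2)): if `NTIME t` does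
not have witness circuits of size `w`, some `L ∈ NTIME t` and some `t`-verifier `V` of `L` have,
at infinitely many lengths `n`, an input `x ∈ L` of length `n` none of whose accepted witnesses
(inside the length bound) is a prefix of the truth table of a `B₂`-circuit with `≤ w n` gates —
the literal negation of `HasWitnessCircuits`. [cite: MurrayWilliams2018, Lemma 4.1 (proof)] -/
theorem exists_verifier_bad_prefix {t w : ℕ → ℕ} (h : ¬ NTIMEHasWitnessCircuits t w) :
    ∃ (L : Language Bool) (_ : L ∈ NTIME t) (V : NVerifier t L),
      ∃ᶠ n in atTop, ∃ xh ∈ L, xh.length = n ∧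
        ∀ (m : ℕ) (W : Circuit (Fin m)) (y : List Bool), W.IsOver B2 → W.size ≤ w n →
          y.length ≤ V.c * t xh.length + V.c → V.rel xh y = true →
            ¬ y <+: MetaComplexity.truthTable W.eval := by
  simp only [NTIMEHasWitnessCircuits, HasWitnessCircuits, not_forall] at h
  obtain ⟨L, hL, V, hV⟩ := h
  refine ⟨L, hL, V, frequently_atTop.2 fun n₀ => ?_⟩
  by_contra hcon
  push Not at hcon
  refine hV ⟨n₀, fun x hx hle => ?_⟩
  obtain ⟨m, W, y, hB, hs, hy, hrel, hpre⟩ := hcon x.length hle x hx rfl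
  exact ⟨m, W, y, hB, hs, hy, hrel, hpre⟩

/-! ### Arthur's predicate as small circuits with a universal exponent -/

/-- **`DTIME(nᴷ)` has circuits of size `O((n+1)^{2K+1})` in the pair form** (Arora–Barak 2009,
Thm. 6.6, with the exponent made explicit: the tableau simulation `FinTM2.exists_cktSize_sim`
gives size `c₀ (S+1)(T+1)`, `T = c nᴷ + c`, `S = n + D T + 1`): for `Ref ∈ DTIME(nᴷ)` there is a
constant `Cq` such that for all `n`, `m` the map `(u, v) ↦ [⟨u, v⟩ ∈ Ref]` on `n + m` bits has
`B₂`-circuits of size `≤ Cq (2n + 2 + m + 1)^{2K+1}` (the wiring of the pair word,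
`cktSize_pairVec`, followed by the simulating circuit). [cite: AroraBarak2009, Thm. 6.6] -/
theorem exists_cktSize_boolPair_of_mem_DTIME_pow {Ref : Language Bool} {K : ℕ}
    (hR : Ref ∈ DTIME fun n => n ^ K) :
    ∃ Cq : ℕ, ∀ n m : ℕ,
      CktSize B2 (fun (w : Fin n ⊕ Fin m → Bool) (_ : Unit) =>
        Ref.boolIndicator
          (boolPair (List.ofFn fun i => w (.inl i)) (List.ofFn fun j => w (.inr j))))
        (Cq * (2 * n + 2 + m + 1) ^ (2 * K + 1)) := by
  simp only [DTIME, TimeClass, Set.mem_setOf_eq] at hR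
  obtain ⟨c, M, hM⟩ := hR
  obtain ⟨c₀, D, hsim⟩ := FinTM2.exists_cktSize_sim M.tm (fun b => M.inputAlphabet.symm b)
    (M.outputAlphabet.symm true)
  set T : ℕ → ℕ := fun n => c * n ^ K + c with hT
  set S : ℕ → ℕ := fun n => n + D * T n + 1 with hS
  choose F hF hspec using fun n => hsim n (T n) (S n) (by simp [hS])
  -- the simulating circuit decides `Ref`
  have hdec : ∀ (N : ℕ) (x : Fin N → Bool), F N x () = Ref.boolIndicator (List.ofFn x) := by
    intro N x
    have hx : Nonempty (TM2OutputsInTime M.tm (List.ofFn fun i => M.inputAlphabet.symm (x i))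
        (some [M.outputAlphabet.symm (Ref.boolIndicator (List.ofFn x))]) (T N)) := by
      have e : (List.ofFn x).map M.inputAlphabet.symm = List.ofFn fun i => M.inputAlphabet.symm (x i) := by
        rw [List.map_ofFn]; rfl
      have hp : ∀ b : Bool, (pure b : List Bool) = [b] := fun _ => rfl
      have := hM (List.ofFn x)
      simp only [TM2ComputableAux.OutputsWithin, Computability.encodeBool, id, hp, List.map_cons,
        List.map_nil, e, List.length_ofFn] at this
      exact this
    have key := hspec N x _ [] hx
    rw [Equiv.apply_eq_iff_eq] at key
    rw [Bool.eq_iff_iff, key]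
  -- the size `c₀ (S+1)(T+1) ≤ Cq (n+1)^{2K+1}`
  have hsize : ∃ Cq : ℕ, ∀ n, c₀ * (S n + 1) * (T n + 1) ≤ Cq * (n + 1) ^ (2 * K + 1) := by
    refine ⟨c₀ * ((D * (2 * c + 1) + 2) * (2 * c + 1)), fun n => ?_⟩
    have h1 : n ^ K ≤ (n + 1) ^ K := Nat.pow_le_pow_left (Nat.le_succ n) K
    have h2 : 1 ≤ (n + 1) ^ K := Nat.one_le_pow _ _ (Nat.succ_pos n)
    have hT1 : T n + 1 ≤ (2 * c + 1) * (n + 1) ^ K := by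
      simp only [hT]; nlinarith
    have h3 : n + 1 ≤ (n + 1) ^ (K + 1) := by
      calc n + 1 = (n + 1) ^ 1 := (pow_one _).symm
        _ ≤ (n + 1) ^ (K + 1) := Nat.pow_le_pow_right (Nat.succ_pos n) (by omega)
    have h4 : (n + 1) ^ K ≤ (n + 1) ^ (K + 1) := Nat.pow_le_pow_right (Nat.succ_pos n) (by omega)
    have hS1 : S n + 1 ≤ (D * (2 * c + 1) + 2) * (n + 1) ^ (K + 1) := by
      have : S n + 1 = (n + 1) + D * T n + 1 := by simp only [hS]; ring
      rw [this]
      have h5 : D * T n ≤ D * ((2 * c + 1) * (n + 1) ^ K) := Nat.mul_le_mul_left _ (by omega)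
      have h6 : 1 ≤ (n + 1) ^ (K + 1) := Nat.one_le_pow _ _ (Nat.succ_pos n)
      have h7 : D * ((2 * c + 1) * (n + 1) ^ K) ≤ D * (2 * c + 1) * (n + 1) ^ (K + 1) := by
        rw [Nat.mul_assoc]
        exact Nat.mul_le_mul_left _ (Nat.mul_le_mul_left _ h4)
      have e1 : (D * (2 * c + 1) + 2) * (n + 1) ^ (K + 1) =
          D * (2 * c + 1) * (n + 1) ^ (K + 1) + (n + 1) ^ (K + 1) + (n + 1) ^ (K + 1) := by ring
      rw [e1]
      omega
    calc c₀ * (S n + 1) * (T n + 1)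
        ≤ c₀ * ((D * (2 * c + 1) + 2) * (n + 1) ^ (K + 1)) * ((2 * c + 1) * (n + 1) ^ K) := by
          gcongr
      _ = c₀ * ((D * (2 * c + 1) + 2) * (2 * c + 1)) * ((n + 1) ^ (K + 1) * (n + 1) ^ K) := by ring
      _ = c₀ * ((D * (2 * c + 1) + 2) * (2 * c + 1)) * (n + 1) ^ (2 * K + 1) := by
          rw [← pow_add]; ring_nf
  obtain ⟨Cq, hCq⟩ := hsize
  refine ⟨Cq + 1, fun n m => ?_⟩
  have h1 := cktSize_pairVec n m
  have h2 := (hF (2 * n + 2 + m)).of_le (hCq (2 * n + 2 + m))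
  refine ((h1.comp h2).of_le ?_).congr fun w _ => ?_
  · have : 2 * n + 2 + m ≤ (2 * n + 2 + m + 1) ^ (2 * K + 1) := by
      calc 2 * n + 2 + m ≤ 2 * n + 2 + m + 1 := Nat.le_succ _
        _ = (2 * n + 2 + m + 1) ^ 1 := (pow_one _).symm
        _ ≤ (2 * n + 2 + m + 1) ^ (2 * K + 1) := Nat.pow_le_pow_right (Nat.succ_pos _) (by omega)
    nlinarith
  · rw [hdec, ofFn_pairVec]

/-- **Arthur's predicate with the board hard-wired is a small circuit of universal degree.** For
`Ref ∈ DTIME(nᴷ)` there is `Cq` such that for every word `X`, every `m ≤ N`, some `B₂`-circuit on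
`N` inputs of size `≤ Cq (2|X| + m + 3)^{2K+1} + 2` has value `[⟨X, r↾m⟩ ∈ Ref]` at every `r`
(`exists_circuit_hardwire`, `PRGDerandomization.lean`). (The tree's `MATests.exists_circuit` gives the same with
a polynomial depending on `Ref`; here only the constant does.) [cite: AroraBarak2009, Thm. 6.6] -/
theorem exists_arthur_circuits {Ref : Language Bool} {K : ℕ} (hR : Ref ∈ DTIME fun n => n ^ K) :
    ∃ Cq : ℕ, ∀ (X : List Bool) (m N : ℕ) (hmN : m ≤ N),
      ∃ C : Circuit (Fin N), C.IsOver B2 ∧ C.size ≤ Cq * (2 * X.length + m + 3) ^ (2 * K + 1) + 2 ∧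
        ∀ r, C.eval r = Ref.boolIndicator (boolPair X (List.ofFn fun j : Fin m => r (Fin.castLE hmN j))) := by
  obtain ⟨Cq, hCq⟩ := exists_cktSize_boolPair_of_mem_DTIME_pow hR
  refine ⟨Cq, fun X m N hmN => ?_⟩
  obtain ⟨C, hB, hs, hC⟩ := exists_circuit_hardwire (hCq X.length m) X rfl hmN
  refine ⟨C, hB, hs.trans (by ring_nf; rfl), hC⟩

/-! ### Enlarging the exponent of the time bound -/

/-- `NTIME (t · ^ E) ⊆ NTIME (t · ^ e)` for `1 ≤ E ≤ e` and time-constructible `t`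
(`NTIME_mono_holds`; `tᴱ` is time constructible, `IsTimeConstructible.pow`). [folklore] -/
theorem NTIME_pow_mono {t : ℕ → ℕ} (ht : IsTimeConstructible t) {E e : ℕ} (hE : 1 ≤ E) (h : E ≤ e) :
    NTIME (fun n => t n ^ E) ⊆ NTIME (fun n => t n ^ e) := by
  refine NTIME_mono_holds (ht.pow hE) fun n => ?_
  rcases Nat.eq_zero_or_pos (t n) with h0 | hpos
  · simp [h0, Nat.pos_iff_ne_zero.1 hE, show e ≠ 0 by omega]
  · exact Nat.pow_le_pow_right hpos h

/-! ### Arithmetic of the parameters `s'`, `s₂'`, `s₁'`, `mv` (p. 13) -/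

section Params

variable {s : ℕ → ℕ} (hs : StrictMono s) {e d' : ℕ}

include hs in
/-- `m ≤ s'(m) = s(e·m)` for `e ≥ 1`. [folklore] -/
theorem le_sigma' (he : 1 ≤ e) (m : ℕ) : m ≤ s (e * m) :=
  (Nat.le_mul_of_pos_left m he).trans (hs.id_le _)

include hs in
/-- `s₂'(n) = s'(n)^{d'} ≤ s'(n)ᵉ = s₂(n)` for `1 ≤ d' ≤ e`. [cite: MurrayWilliams2018, Lemma 4.1 (proof)] -/
theorem sigma2'_le_stretch (hd : 1 ≤ d') (hde : d' ≤ e) (n : ℕ) :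
    s (e * n) ^ d' ≤ stretch s e n := by
  have _ := hs
  rw [stretch_apply]
  exact pow_le_pow_right_of_one_le hd hde

include hs in
/-- **The move length is below `s₂'(s₂'(n))`** (p. 13: "`s₁'(n)² · s₂'(n)^{d₃} = s'(s₂'(n))² ·
s₂'(n)^{d₃} ≤ s'(s₂'(n))^{2+d₃} ≤ s₂'(s₂'(n))`" for `d' ≥ d₃ + 2`).
[cite: MurrayWilliams2018, Lemma 4.1 (proof)] -/
theorem mv_le_sigma2'_sigma2' {d₃ : ℕ} (he : 1 ≤ e) (hd : d₃ + 2 ≤ d') (n : ℕ) :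
    s (e * (s (e * n) ^ d')) ^ 2 * (s (e * n) ^ d') ^ d₃ ≤ s (e * (s (e * n) ^ d')) ^ d' := by
  set m := s (e * n) ^ d' with hm
  have h1 : m ≤ s (e * m) := le_sigma' hs he m
  calc s (e * m) ^ 2 * m ^ d₃ ≤ s (e * m) ^ 2 * s (e * m) ^ d₃ :=
        Nat.mul_le_mul_left _ (Nat.pow_le_pow_left h1 _)
    _ = s (e * m) ^ (d₃ + 2) := by rw [← pow_add, add_comm]
    _ ≤ s (e * m) ^ d' := pow_le_pow_right_of_one_le (by omega) hd

include hs in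
/-- **The move length is below `s₂(s₂(ℓ))`**, hence below `s₂³(ℓ)`: for `1 ≤ d' ≤ e`,
`d' ≥ d₃ + 2`. [cite: MurrayWilliams2018, Lemma 4.1 (proof)] -/
theorem mv_le_stretch_stretch {d₃ : ℕ} (he : 1 ≤ e) (hd : d₃ + 2 ≤ d') (hde : d' ≤ e) (ℓ : ℕ) :
    s (e * (s (e * ℓ) ^ d')) ^ 2 * (s (e * ℓ) ^ d') ^ d₃ ≤ stretch s e (stretch s e ℓ) := by
  have hd1 : 1 ≤ d' := by omega
  refine (mv_le_sigma2'_sigma2' hs he hd ℓ).trans ?_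
  calc s (e * (s (e * ℓ) ^ d')) ^ d' ≤ stretch s e (s (e * ℓ) ^ d') := sigma2'_le_stretch hs hd1 hde _
    _ ≤ stretch s e (stretch s e ℓ) :=
        stretch_monotone hs.monotone e (sigma2'_le_stretch hs hd1 hde ℓ)

include hs in
/-- **Advice length**: if `|adv ℓ| ≤ 2 log₂ (s₂'(ℓ)) + 2` and `s'(ℓ) < 2^ℓ` then
`|adv ℓ| ≤ 2 d' ℓ + 2` for `d' ≥ 1` (`s₂'(ℓ) = s'(ℓ)^{d'} < 2^{d' ℓ}`; p. 13: "advice of length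
`2 log s₂(n) = 2d log s'(n) < 2d · log(2^{e·n/e}) = 2d · n`"). [cite: MurrayWilliams2018, Lemma 4.1 (proof)] -/
theorem advice_length_le {a ℓ : ℕ} (hd : 1 ≤ d') (ha : a ≤ 2 * Nat.log 2 (s (e * ℓ) ^ d') + 2)
    (hlt : s (e * ℓ) < 2 ^ ℓ) : a ≤ 2 * (d' * ℓ) + 2 := by
  have _ := hs
  have h1 : s (e * ℓ) ^ d' < 2 ^ (d' * ℓ) := by
    calc s (e * ℓ) ^ d' < (2 ^ ℓ) ^ d' := Nat.pow_lt_pow_left hlt (by omega)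
      _ = 2 ^ (d' * ℓ) := by rw [← pow_mul, mul_comm]
  have h2 : Nat.log 2 (s (e * ℓ) ^ d') < d' * ℓ + 1 := by
    rcases Nat.eq_zero_or_pos (s (e * ℓ) ^ d') with h0 | hpos
    · rw [h0]; simp
    · exact Nat.lt_succ_of_lt (Nat.log_lt_of_lt_pow hpos.ne' h1)
  omega

end Params

/-! ### Eventual bounds become uniform bounds with a constant -/

/-- If `f n ≤ g n` for all large `n` then `f n ≤ g n + C` for all `n` and some `C`. (Twin of
`MWSimN.exists_add_const_of_eventually_le`, `MurrayWilliams2018SimulationMachine.lean`, whose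
import closure — `IKWSimulationMachine`, `Williams2014MachineB` — is not wanted in this
machine-free file.) [folklore] -/
theorem exists_add_const_of_eventually_le {f g : ℕ → ℕ} (h : ∀ᶠ n in atTop, f n ≤ g n) :
    ∃ C : ℕ, ∀ n, f n ≤ g n + C := by
  obtain ⟨N, hN⟩ := eventually_atTop.1 h
  refine ⟨∑ i ∈ Finset.range N, f i, fun n => ?_⟩
  rcases lt_or_ge n N with hn | hn
  · have : f n ≤ ∑ i ∈ Finset.range N, f i :=
      Finset.single_le_sum (fun i _ => Nat.zero_le (f i)) (Finset.mem_range.2 hn)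
    omega
  · exact (hN n hn).trans (Nat.le_add_right _ _)

/-! ### Arithmetic of the hardness level -/

/-- The base of the output length: `ℓ + a + m + 2 ≤ (2d' + 6) B` when `ℓ, m ≤ B`, `1 ≤ B` and
`a ≤ 2 d' ℓ + 2`. [folklore] -/
theorem base_le {ℓ a m B d' : ℕ} (hℓ : ℓ ≤ B) (ha : a ≤ 2 * (d' * ℓ) + 2) (hm : m ≤ B) (hB : 1 ≤ B) :
    ℓ + a + m + 2 ≤ (2 * d' + 6) * B := by
  have h1 : d' * ℓ ≤ d' * B := Nat.mul_le_mul_left _ hℓ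
  have e1 : (2 * d' + 6) * B = 2 * (d' * B) + 6 * B := by ring
  rw [e1]
  omega

/-- The hardness bookkeeping: if `x ≤ A · B^{2K+2}` and `A^{g_U} ≤ B` then
`x^{g_U} ≤ B^{2((K+1) g_U + 1)}`. [folklore] -/
theorem pow_le_w {x A B K gU : ℕ} (hx : x ≤ A * B ^ (2 * K + 2)) (hA : A ^ gU ≤ B) :
    x ^ gU ≤ B ^ (2 * ((K + 1) * gU + 1)) := by
  calc x ^ gU ≤ (A * B ^ (2 * K + 2)) ^ gU := Nat.pow_le_pow_left hx _
    _ = A ^ gU * B ^ ((2 * K + 2) * gU) := by rw [mul_pow, ← pow_mul]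
    _ ≤ B * B ^ ((2 * K + 2) * gU) := Nat.mul_le_mul_right _ hA
    _ = B ^ ((2 * K + 2) * gU + 1) := by rw [pow_succ, mul_comm]
    _ ≤ B ^ (2 * ((K + 1) * gU + 1)) := by
        refine pow_le_pow_right_of_one_le (by omega) ?_
        have : (2 * K + 2) * gU = 2 * ((K + 1) * gU) := by ring
        omega

/-- The output length dominates Arthur's circuit size: for `Y ≥ 2`,
`Cq (8 Y)^{2K+1} + 2 ≤ (Cq 8^{2K+1} + 1) Y^{2K+2} + 7`. [folklore] -/
theorem arthur_size_le_Nb {Cq Y K : ℕ} (hY : 2 ≤ Y) :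
    Cq * (8 * Y) ^ (2 * K + 1) + 2 ≤ (Cq * 8 ^ (2 * K + 1) + 1) * Y ^ (2 * K + 2) + 7 := by
  have h1 : Y ^ (2 * K + 1) ≤ Y ^ (2 * K + 2) := Nat.pow_le_pow_right (by omega) (by omega)
  have h2 : Cq * (8 * Y) ^ (2 * K + 1) = Cq * 8 ^ (2 * K + 1) * Y ^ (2 * K + 1) := by
    rw [mul_pow]; ring
  rw [h2]
  have h3 : Cq * 8 ^ (2 * K + 1) * Y ^ (2 * K + 1) ≤ Cq * 8 ^ (2 * K + 1) * Y ^ (2 * K + 2) :=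
    Nat.mul_le_mul_left _ h1
  have e1 : (Cq * 8 ^ (2 * K + 1) + 1) * Y ^ (2 * K + 2) =
      Cq * 8 ^ (2 * K + 1) * Y ^ (2 * K + 2) + Y ^ (2 * K + 2) := by ring
  rw [e1]
  omega

/-- `Y ≤ Y^{2K+2}` bounds: `m + 2 ≤ Y` gives `m ≤ C Y^{2K+2} + 7` for `C ≥ 1`. [folklore] -/
theorem le_Nb_of_le {m Y C K : ℕ} (hm : m + 2 ≤ Y) (hC : 1 ≤ C) : m ≤ C * Y ^ (2 * K + 2) + 7 := by
  have h1 : Y ≤ Y ^ (2 * K + 2) := by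
    calc Y = Y ^ 1 := (pow_one _).symm
      _ ≤ Y ^ (2 * K + 2) := Nat.pow_le_pow_right (by omega) (by omega)
  have h2 : Y ^ (2 * K + 2) ≤ C * Y ^ (2 * K + 2) := Nat.le_mul_of_pos_left _ hC
  omega

/-! ### The contradiction (proof of Lemma 4.1, pp. 13–14) -/

section Contradiction

/-- **The simulation decides `L₁` on a good length, hence `cs(L₁, ℓ) ≤ cs(simLang, 2ℓ + |βℓ| + 2) + 2`.**
On a length `ℓ` with advice `βℓ = ⟨x_h, adv⟩` — `x_h ∈ L` bad at level `H` for `V`, hard functions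
of that level arming the generator at output length `Nb ℓ |adv|`, Arthur's predicates circuits of
size `≤ Nb`, the promise of the game holding with `L₁`, the kept length adequate — every `x` of length
`ℓ` has `x ∈ L₁ ↔ ⟨x, βℓ⟩ ∈ simLang`, so `L₁.circuitSize ℓ ≤ simLang.circuitSize (2ℓ + |βℓ| + 2) + 2`
(`circuitSize_le_of_slice_agree`). [cite: MurrayWilliams2018, Lemma 4.1 (proof)] -/
theorem circuitSize_L₁_le {t : ℕ → ℕ} {L : Language Bool} (V : NVerifier t L) {Ref L₁ : Language Bool}
    {F : List Bool → List Bool} {γ : ℕ} {mv : ℕ → ℕ} {Nb : ℕ → ℕ → ℕ} {U : ℕ → ℕ}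
    (xh : List Bool) (hxh : xh ∈ L) (adv : List Bool) (ℓ H : ℕ)
    (hbad : ∀ (m : ℕ) (W : Circuit (Fin m)) (y : List Bool), W.IsOver B2 → W.size ≤ H →
      y.length ≤ bound t V xh.length → V.rel xh y = true → ¬ y <+: truthTable W.eval)
    (hfool : ∀ f : (Fin (scale t V xh.length) → Bool) → Bool, H < circuitSizeOver B2 f →
      IsSizePseudorandom (tableGenerator F f (γ * scale t V xh.length) (Nb ℓ adv.length)))
    (hmnb : mv ℓ ≤ Nb ℓ adv.length) (h7 : 7 ≤ Nb ℓ adv.length)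
    (hC : ∀ (x z : List Bool), x.length = ℓ → z.length = mv ℓ →
      ∃ C : Circuit (Fin (Nb ℓ adv.length)), C.IsOver B2 ∧ C.size ≤ Nb ℓ adv.length ∧
        ∀ r, C.eval r = Ref.boolIndicator (boolPair (boolPair (boolPair x adv) z)
          (List.ofFn fun i : Fin (mv ℓ) => r (Fin.castLE hmnb i))))
    (hU : ∀ N, 2 * ℓ + (2 * xh.length + adv.length + 2) + 2 ≤ N →
      2 * bound t V xh.length + mv ℓ + 2 ≤ U N)
    (hyes : ∀ x : List Bool, x.length = ℓ → x ∈ L₁ → ∃ z : List Bool, z.length = mv ℓ ∧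
      (2 / 3 : ℝ) ≤ uniformProb (mv ℓ) {r | boolPair (boolPair (boolPair x adv) z) r ∈ Ref})
    (hno : ∀ x : List Bool, x.length = ℓ → x ∉ L₁ → ∀ z : List Bool, z.length = mv ℓ →
      uniformProb (mv ℓ) {r | boolPair (boolPair (boolPair x adv) z) r ∈ Ref} ≤ 1 / 3) :
    L₁.circuitSize ℓ ≤
      (simLang t V Ref F γ mv Nb U).circuitSize (2 * ℓ + (boolPair xh adv).length + 2) + 2 := by
  classical
  refine circuitSize_le_of_slice_agree (boolPair xh adv) ℓ fun x hx => ?_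
  have hbad' := hard_tables_of_bad V xh hbad
  subst hx
  have hUx : 2 * bound t V xh.length + mv x.length + 2 ≤ U (boolPair x (boolPair xh adv)).length :=
    hU _ (by simp only [length_boolPair]; omega)
  constructor
  · intro hx1
    exact mem_simLang_of_accepted V γ mv Nb U x xh adv hxh hbad' hfool hmnb h7
      (fun z hz => hC x z rfl hz) hUx (hyes x rfl hx1)
  · intro hmem
    by_contra hx1
    exact not_mem_simLang_of_rejected V γ mv Nb U x xh adv hbad' hfool hmnb h7
      (fun z hz => hC x z rfl hz) (hno x rfl hx1) hmem

variable {s t : ℕ → ℕ} {e d' d₃ K gU CNb Cq : ℕ}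

/-- **The key estimate of §4 at one length.** With the parameters of the proof — `s' = s(e·)`,
`s₂' = s'^{d'}`, `mv = s'(s₂')² · s₂'^{d₃}`, `Nb ℓ a = CNb (ℓ + a + mv ℓ + 2)^{2K+2} + 7`,
`CNb = Cq 8^{2K+1} + 1`, hardness level `w = B^{2((K+1) g_U + 1)}`, `B = s₂³(n)` — on a length `ℓ`
with `n ≤ ℓ ≤ s₂(n)` (so `ℓ`, `mv ℓ ≤ B`), a bad input `x_h ∈ L` of `V` of length `≤ ℓ` at level `w`,
advice of length `≤ 2 log₂ s₂'(ℓ) + 2` with `s'(ℓ) < 2^ℓ`, `A^{g_U} ≤ B` for the constant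
`A = CNb (2d'+6)^{2K+2} + 7` (so that `Nb^{g_U} ≤ w` and Umans' generators are fooled): if the
simulation language has `s(N)`-size circuits at the length `N = 2ℓ + |⟨x_h, adv ℓ⟩| + 2` and
`e ≥ 2d' + 12`, then `cs(L₁, ℓ) ≤ s(e ℓ)`. [cite: MurrayWilliams2018, Lemma 4.1 (proof)] -/
theorem circuitSize_L₁_le_sigma' (hs : StrictMono s) (htm : Monotone t) (he : 2 * d' + 12 ≤ e)
    (hd1 : 1 ≤ d')
    {F : List Bool → List Bool}
    (hPRG : ∀ (m u : ℕ) (f : (Fin m → Bool) → Bool), 1 ≤ u → u ^ gU ≤ circuitSizeOver B2 f →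
      IsSizePseudorandom (tableGenerator F f (gU * m) u))
    {L₁ Ref : Language Bool} {adv : ℕ → List Bool}
    (hyes : ∀ x : List Bool, x ∈ L₁ → ∃ z : List Bool,
      z.length = s (e * (s (e * x.length) ^ d')) ^ 2 * (s (e * x.length) ^ d') ^ d₃ ∧
      (2 / 3 : ℝ) ≤ uniformProb (s (e * (s (e * x.length) ^ d')) ^ 2 * (s (e * x.length) ^ d') ^ d₃)
        {r | boolPair (boolPair (boolPair x (adv x.length)) z) r ∈ Ref})
    (hno : ∀ x : List Bool, x ∉ L₁ → ∀ z : List Bool,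
      z.length = s (e * (s (e * x.length) ^ d')) ^ 2 * (s (e * x.length) ^ d') ^ d₃ →
      uniformProb (s (e * (s (e * x.length) ^ d')) ^ 2 * (s (e * x.length) ^ d') ^ d₃)
        {r | boolPair (boolPair (boolPair x (adv x.length)) z) r ∈ Ref} ≤ 1 / 3)
    (hCq : ∀ (X : List Bool) (m N : ℕ) (hmN : m ≤ N),
      ∃ C : Circuit (Fin N), C.IsOver B2 ∧ C.size ≤ Cq * (2 * X.length + m + 3) ^ (2 * K + 1) + 2 ∧
        ∀ r, C.eval r = Ref.boolIndicator (boolPair X (List.ofFn fun j : Fin m => r (Fin.castLE hmN j))))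
    (hCNb : CNb = Cq * 8 ^ (2 * K + 1) + 1)
    {L : Language Bool} (V : NVerifier t L)
    -- the length, the bad input, the thresholds
    {n ℓ B : ℕ} (hnℓ : n ≤ ℓ) (h1n : 1 ≤ n) (hℓB : ℓ ≤ B)
    (hmvB : s (e * (s (e * ℓ) ^ d')) ^ 2 * (s (e * ℓ) ^ d') ^ d₃ ≤ B)
    (hmvmono : Monotone fun n => s (e * (s (e * n) ^ d')) ^ 2 * (s (e * n) ^ d') ^ d₃)
    {xh : List Bool} (hxhL : xh ∈ L) (hxhn : xh.length = n)
    (hbadn : ∀ (m : ℕ) (W : Circuit (Fin m)) (y : List Bool), W.IsOver B2 →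
      W.size ≤ B ^ (2 * ((K + 1) * gU + 1)) →
      y.length ≤ V.c * t xh.length + V.c → V.rel xh y = true → ¬ y <+: truthTable W.eval)
    (hadvℓ : (adv ℓ).length ≤ 2 * Nat.log 2 (s (e * ℓ) ^ d') + 2) (hslt : s (e * ℓ) < 2 ^ ℓ)
    (hAn : (CNb * (2 * d' + 6) ^ (2 * K + 2) + 7) ^ gU ≤ B)
    (hcirc : (simLang t V Ref F gU
        (fun n => s (e * (s (e * n) ^ d')) ^ 2 * (s (e * n) ^ d') ^ d₃)
        (fun ℓ a => CNb * (ℓ + a + (s (e * (s (e * ℓ) ^ d')) ^ 2 * (s (e * ℓ) ^ d') ^ d₃) + 2) ^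
          (2 * K + 2) + 7)
        (fun N => 2 * bound t V N + (s (e * (s (e * N) ^ d')) ^ 2 * (s (e * N) ^ d') ^ d₃) + 2)).circuitSize
        (2 * ℓ + (boolPair xh (adv ℓ)).length + 2) ≤ s (2 * ℓ + (boolPair xh (adv ℓ)).length + 2)) :
    L₁.circuitSize ℓ ≤ s (e * ℓ) := by
  classical
  -- names for the move length at `ℓ` and the output length
  set m : ℕ := s (e * (s (e * ℓ) ^ d')) ^ 2 * (s (e * ℓ) ^ d') ^ d₃ with hm
  have hB1 : 1 ≤ B := h1n.trans (hnℓ.trans hℓB)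
  have hℓ1 : 1 ≤ ℓ := h1n.trans hnℓ
  have hCNb1 : 1 ≤ CNb := by rw [hCNb]; exact Nat.le_add_left _ _
  -- advice length and the base of `Nb`
  have hadv' : (adv ℓ).length ≤ 2 * (d' * ℓ) + 2 := advice_length_le hs hd1 hadvℓ hslt
  have hbase : ℓ + (adv ℓ).length + m + 2 ≤ (2 * d' + 6) * B := base_le hℓB hadv' hmvB hB1
  -- the output length and its hardness bookkeeping
  set nb : ℕ := CNb * (ℓ + (adv ℓ).length + m + 2) ^ (2 * K + 2) + 7 with hnb
  have hnbA : nb ≤ (CNb * (2 * d' + 6) ^ (2 * K + 2) + 7) * B ^ (2 * K + 2) := by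
    have h1 : (ℓ + (adv ℓ).length + m + 2) ^ (2 * K + 2) ≤ (2 * d' + 6) ^ (2 * K + 2) * B ^ (2 * K + 2) := by
      rw [← mul_pow]; exact Nat.pow_le_pow_left hbase _
    have h2 : 1 ≤ B ^ (2 * K + 2) := Nat.one_le_pow _ _ hB1
    have h3 : CNb * (ℓ + (adv ℓ).length + m + 2) ^ (2 * K + 2) ≤
        CNb * ((2 * d' + 6) ^ (2 * K + 2) * B ^ (2 * K + 2)) := Nat.mul_le_mul_left _ h1
    have e1 : (CNb * (2 * d' + 6) ^ (2 * K + 2) + 7) * B ^ (2 * K + 2) =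
        CNb * ((2 * d' + 6) ^ (2 * K + 2) * B ^ (2 * K + 2)) + 7 * B ^ (2 * K + 2) := by ring
    rw [hnb, e1]
    omega
  have hnbw : nb ^ gU ≤ B ^ (2 * ((K + 1) * gU + 1)) := pow_le_w hnbA hAn
  have h7 : 7 ≤ nb := by rw [hnb]; omega
  have hmnb : m ≤ nb := by rw [hnb]; exact le_Nb_of_le (by omega) hCNb1
  -- the generator is fooled at level `w`
  have hfool : ∀ f : (Fin (scale t V xh.length) → Bool) → Bool,
      B ^ (2 * ((K + 1) * gU + 1)) < circuitSizeOver B2 f →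
      IsSizePseudorandom (tableGenerator F f (gU * scale t V xh.length) nb) :=
    fun f hf => hPRG _ _ f (by omega) (hnbw.trans hf.le)
  -- Arthur's circuits
  have hC : ∀ (x z : List Bool), x.length = ℓ → z.length = m →
      ∃ C : Circuit (Fin nb), C.IsOver B2 ∧ C.size ≤ nb ∧
        ∀ r, C.eval r = Ref.boolIndicator (boolPair (boolPair (boolPair x (adv ℓ)) z)
          (List.ofFn fun i : Fin m => r (Fin.castLE hmnb i))) := by
    intro x z hx hz
    obtain ⟨C, hB, hsz, hCe⟩ := hCq (boolPair (boolPair x (adv ℓ)) z) m nb hmnb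
    refine ⟨C, hB, hsz.trans ?_, hCe⟩
    have hX : 2 * (boolPair (boolPair x (adv ℓ)) z).length + m + 3 ≤ 8 * (ℓ + (adv ℓ).length + m + 2) := by
      simp only [length_boolPair, hx, hz]; omega
    calc Cq * (2 * (boolPair (boolPair x (adv ℓ)) z).length + m + 3) ^ (2 * K + 1) + 2
        ≤ Cq * (8 * (ℓ + (adv ℓ).length + m + 2)) ^ (2 * K + 1) + 2 :=
          Nat.add_le_add_right (Nat.mul_le_mul_left _ (Nat.pow_le_pow_left hX _)) _
      _ ≤ (Cq * 8 ^ (2 * K + 1) + 1) * (ℓ + (adv ℓ).length + m + 2) ^ (2 * K + 2) + 7 :=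
          arthur_size_le_Nb (by omega)
      _ = nb := by rw [hnb, hCNb]
  -- the slice estimate
  have hcs := circuitSize_L₁_le (γ := gU) (mv := fun n => s (e * (s (e * n) ^ d')) ^ 2 * (s (e * n) ^ d') ^ d₃)
    (Nb := fun ℓ a => CNb * (ℓ + a + (s (e * (s (e * ℓ) ^ d')) ^ 2 * (s (e * ℓ) ^ d') ^ d₃) + 2) ^
      (2 * K + 2) + 7)
    (U := fun N => 2 * bound t V N + (s (e * (s (e * N) ^ d')) ^ 2 * (s (e * N) ^ d') ^ d₃) + 2)
    (Ref := Ref) (L₁ := L₁) (F := F) V xh hxhL (adv ℓ) ℓ (B ^ (2 * ((K + 1) * gU + 1)))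
    hbadn hfool hmnb h7 hC
    (fun N hN => by
      have h1 : bound t V xh.length ≤ bound t V N := by
        simp only [bound]
        exact Nat.add_le_add_right (Nat.mul_le_mul_left _ (htm (by omega))) _
      have h2 : m ≤ s (e * (s (e * N) ^ d')) ^ 2 * (s (e * N) ^ d') ^ d₃ :=
        hmvmono (show ℓ ≤ N by omega)
      change 2 * bound t V xh.length + m + 2 ≤
        2 * bound t V N + s (e * (s (e * N) ^ d')) ^ 2 * (s (e * N) ^ d') ^ d₃ + 2
      omega)
    (fun x hx hx1 => by have := hyes x hx1; rwa [hx] at this)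
    (fun x hx hx1 z hz => by
      have h1 := hno x hx1 z (by rw [hx]; exact hz)
      rwa [hx] at h1)
  -- the circuit bound (c) at length `2ℓ + |βℓ| + 2 ≤ e ℓ - 2`
  have hlen : 2 * ℓ + (boolPair xh (adv ℓ)).length + 2 + 2 ≤ e * ℓ := by
    simp only [length_boolPair]
    have h1 : xh.length ≤ ℓ := by omega
    have h2 : (2 * d' + 12) * ℓ ≤ e * ℓ := Nat.mul_le_mul_right _ he
    have e1 : (2 * d' + 12) * ℓ = 2 * (d' * ℓ) + 12 * ℓ := by ring
    omega
  have hsmono : s (2 * ℓ + (boolPair xh (adv ℓ)).length + 2) + 2 ≤ s (e * ℓ) :=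
    (add_le_apply_add_of_strictMono hs _ 2).trans (hs.monotone hlen)
  exact hcs.trans ((Nat.add_le_add_right hcirc 2).trans hsmono)

/-- **The contradiction of §4.** With the parameters of the proof and: proviso (a) and the circuit
upper bound (c) of the lemma (at exponent `e`), `e ≥ 2 d' + 12`, `d₃ + 2 ≤ d' ≤ e`; Umans'
generators `F` with constant `g_U`; the output of Thm. 3.1 for `(s', s₁', s₂')` — `L₁`, `Ref`, `adv`
with the advice bound, the promise and the hardness disjunction a.e.; Arthur's circuits with constant
`Cq` and `CNb = Cq · 8^{2K+1} + 1`; a verifier `V` with bad inputs (prefix form, size `w = s₂³^{2g}`,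
`g = (K+1) g_U + 1`) at infinitely many lengths, whose simulation language is in `NTIME (t · ^ e)`
and hypothesis (b) with `d = 1`. Then `False`: at a large bad length `nᵢ`,
`cs(L₁, ℓ) ≤ s(e ℓ)` for both `ℓ = nᵢ` and `ℓ = s₂'(nᵢ)` (`circuitSize_L₁_le_sigma'`), contradicting
the hardness disjunction ("this contradicts the circuit lower bound of Theorem 3.1").
[cite: MurrayWilliams2018, Lemma 4.1 (proof)] -/
theorem false_of_components (hs : StrictMono s) (htm : Monotone t)
    (ha : ∀ᶠ n in atTop, n * s n < 2 ^ (n / e))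
    (hc : ∀ L' ∈ NTIME (fun n => t n ^ e), ∀ᶠ n in atTop, L'.circuitSize n ≤ s n)
    (he : 2 * d' + 12 ≤ e) (hd3 : d₃ + 2 ≤ d') (hde : d' ≤ e)
    {F : List Bool → List Bool}
    (hPRG : ∀ (m u : ℕ) (f : (Fin m → Bool) → Bool), 1 ≤ u → u ^ gU ≤ circuitSizeOver B2 f →
      IsSizePseudorandom (tableGenerator F f (gU * m) u))
    {L₁ Ref : Language Bool} {adv : ℕ → List Bool}
    (hadv : ∀ n, (adv n).length ≤ 2 * Nat.log 2 (s (e * n) ^ d') + 2)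
    (hyes : ∀ x : List Bool, x ∈ L₁ → ∃ z : List Bool,
      z.length = s (e * (s (e * x.length) ^ d')) ^ 2 * (s (e * x.length) ^ d') ^ d₃ ∧
      (2 / 3 : ℝ) ≤ uniformProb (s (e * (s (e * x.length) ^ d')) ^ 2 * (s (e * x.length) ^ d') ^ d₃)
        {r | boolPair (boolPair (boolPair x (adv x.length)) z) r ∈ Ref})
    (hno : ∀ x : List Bool, x ∉ L₁ → ∀ z : List Bool,
      z.length = s (e * (s (e * x.length) ^ d')) ^ 2 * (s (e * x.length) ^ d') ^ d₃ →
      uniformProb (s (e * (s (e * x.length) ^ d')) ^ 2 * (s (e * x.length) ^ d') ^ d₃)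
        {r | boolPair (boolPair (boolPair x (adv x.length)) z) r ∈ Ref} ≤ 1 / 3)
    (hhard : ∀ᶠ n in atTop, s (e * n) < L₁.circuitSize n ∨
      s (e * (s (e * n) ^ d')) < L₁.circuitSize (s (e * n) ^ d'))
    (hCq : ∀ (X : List Bool) (m N : ℕ) (hmN : m ≤ N),
      ∃ C : Circuit (Fin N), C.IsOver B2 ∧ C.size ≤ Cq * (2 * X.length + m + 3) ^ (2 * K + 1) + 2 ∧
        ∀ r, C.eval r = Ref.boolIndicator (boolPair X (List.ofFn fun j : Fin m => r (Fin.castLE hmN j))))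
    (hCNb : CNb = Cq * 8 ^ (2 * K + 1) + 1)
    {L : Language Bool} (V : NVerifier t L)
    (hbad : ∃ᶠ n in atTop, ∃ xh ∈ L, xh.length = n ∧
      ∀ (m : ℕ) (W : Circuit (Fin m)) (y : List Bool), W.IsOver B2 →
        W.size ≤ ((stretch s e)^[3] n) ^ (2 * ((K + 1) * gU + 1)) →
        y.length ≤ V.c * t xh.length + V.c → V.rel xh y = true → ¬ y <+: truthTable W.eval)
    (hsim : simLang t V Ref F gU
        (fun n => s (e * (s (e * n) ^ d')) ^ 2 * (s (e * n) ^ d') ^ d₃)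
        (fun ℓ a => CNb * (ℓ + a + (s (e * (s (e * ℓ) ^ d')) ^ 2 * (s (e * ℓ) ^ d') ^ d₃) + 2) ^
          (2 * K + 2) + 7)
        (fun N => 2 * bound t V N + (s (e * (s (e * N) ^ d')) ^ 2 * (s (e * N) ^ d') ^ d₃) + 2) ∈
      NTIME (fun n => t n ^ e)) :
    False := by
  classical
  have he1 : 1 ≤ e := by omega
  have he2 : 2 ≤ e := by omega
  have hd1 : 1 ≤ d' := by omega
  -- growth facts
  have hS3 : ∀ n, n ≤ (stretch s e)^[3] n := fun n => id_le_stretch_iterate hs he1 3 n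
  have hSmono : Monotone (stretch s e) := stretch_monotone hs.monotone e
  have hS3_eq : ∀ n, (stretch s e)^[3] n = stretch s e (stretch s e (stretch s e n)) := fun n => by
    simp only [Function.iterate_succ_apply', Function.iterate_zero_apply]
  have hS_le_S3 : ∀ n, stretch s e n ≤ (stretch s e)^[3] n := by
    intro n
    rw [hS3_eq]
    exact (id_le_stretch hs he1 _).trans (id_le_stretch hs he1 _)
  have hσ₂_le_S : ∀ n, s (e * n) ^ d' ≤ stretch s e n := fun n => sigma2'_le_stretch hs hd1 hde n
  have hmv_le : ∀ ℓ, s (e * (s (e * ℓ) ^ d')) ^ 2 * (s (e * ℓ) ^ d') ^ d₃ ≤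
      stretch s e (stretch s e ℓ) := fun ℓ => mv_le_stretch_stretch hs he1 hd3 hde ℓ
  have hmvmono : Monotone fun n => s (e * (s (e * n) ^ d')) ^ 2 * (s (e * n) ^ d') ^ d₃ := by
    intro a b hab
    have h1 : s (e * a) ^ d' ≤ s (e * b) ^ d' :=
      Nat.pow_le_pow_left (hs.monotone (Nat.mul_le_mul_left e hab)) _
    have h2 : s (e * (s (e * a) ^ d')) ≤ s (e * (s (e * b) ^ d')) :=
      hs.monotone (Nat.mul_le_mul_left e h1)
    exact Nat.mul_le_mul (Nat.pow_le_pow_left h2 2) (Nat.pow_le_pow_left h1 _)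
  -- (c) for the simulation language; `s'(ℓ) < 2^ℓ` eventually
  obtain ⟨N₀, hN₀⟩ := eventually_atTop.1 (hc _ hsim)
  obtain ⟨ℓ₀, hℓ₀⟩ := eventually_atTop.1 (eventually_two_mul_mul_stretchBase_lt he2 ha)
  have hslt : ∀ ℓ, ℓ₀ ≤ ℓ → 1 ≤ ℓ → s (e * ℓ) < 2 ^ ℓ := by
    intro ℓ hℓ hℓ1
    calc s (e * ℓ) ≤ 2 * ℓ * s (e * ℓ) := Nat.le_mul_of_pos_left _ (by omega)
      _ < 2 ^ ℓ := hℓ₀ ℓ hℓ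
  -- a bad length beyond all thresholds
  have hev : ∀ᶠ n in atTop, (s (e * n) < L₁.circuitSize n ∨
      s (e * (s (e * n) ^ d')) < L₁.circuitSize (s (e * n) ^ d')) ∧
      N₀ ≤ n ∧ ℓ₀ ≤ n ∧ (CNb * (2 * d' + 6) ^ (2 * K + 2) + 7) ^ gU ≤ n ∧ 1 ≤ n :=
    hhard.and ((eventually_ge_atTop N₀).and ((eventually_ge_atTop ℓ₀).and
      ((eventually_ge_atTop _).and (eventually_ge_atTop 1))))
  obtain ⟨n, ⟨xh, hxhL, hxhn, hbadn⟩, hhardn, hN₀n, hℓ₀n, hAn, h1n⟩ := (hbad.and_eventually hev).exists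
  -- the key estimate at both lengths
  have key : ∀ ℓ : ℕ, n ≤ ℓ → ℓ ≤ stretch s e n → L₁.circuitSize ℓ ≤ s (e * ℓ) := by
    intro ℓ hnℓ hℓS
    refine circuitSize_L₁_le_sigma' (d₃ := d₃) (K := K) (gU := gU) (CNb := CNb) (Cq := Cq) hs htm he
      hd1 hPRG hyes hno hCq hCNb V (B := (stretch s e)^[3] n) hnℓ h1n (hℓS.trans (hS_le_S3 n))
      ?_ hmvmono hxhL hxhn hbadn (hadv ℓ) (hslt ℓ (hℓ₀n.trans hnℓ) (h1n.trans hnℓ))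
      (hAn.trans (hS3 n)) (hN₀ _ ?_)
    · refine (hmv_le ℓ).trans ?_
      rw [hS3_eq]
      exact hSmono (hSmono hℓS)
    · have : n ≤ 2 * ℓ + (boolPair xh (adv ℓ)).length + 2 := by omega
      exact hN₀n.trans this
  have hnσ : n ≤ s (e * n) ^ d' := (le_sigma' hs he1 n).trans (Nat.le_self_pow (by omega) _)
  have k1 := key n le_rfl (hnσ.trans (hσ₂_le_S n))
  have k2 := key (s (e * n) ^ d') hnσ (hσ₂_le_S n)
  rcases hhardn with h | h
  · exact absurd k1 (not_le.2 h)
  · exact absurd k2 (not_le.2 h)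

end Contradiction

/-! ### Lemma 4.1 (a.e. form) from Thm. 3.1, Thm. 2.1 and the running time of `N` -/

/-- **Murray–Williams 2018, Lemma 4.1 (almost-everywhere form), conditionally on its two quoted
ingredients and the running time of the simulation.** Hypotheses (module docstring): `h31` =
Thm. 3.1 of the source over the tree (with Arthur's predicate in `DTIME(nᴷ)` for a universal `K`
and the promise of Def. 2.1 on `⟨⟨⟨x, adv |x|⟩, z⟩, r⟩`); `h21` = Thm. 2.1 (Umans 2003, Thm. 6)
over `tableGenerator`/`IsSizePseudorandom`; `hN` = the running time of the derandomized simulation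
`N` of p. 14 (`MWSim.simLang ∈ NTIME (t · ^ E)`, `E` depending on `γ, K, F` only). Conclusion: the
named fact `MurrayWilliams2018_lemma_4_1_ae`, with `e = max E (2d' + 12)`,
`d' = 2d₂ + 2d₁ + d₃ + 3`, `g = (K+1) g_U + 1`, `d = 1` (`false_of_components`).
[cite: MurrayWilliams2018, Lemma 4.1] -/
theorem MurrayWilliams2018_lemma_4_1_ae_of_thm_3_1_of_thm_2_1_of_sim
    (h31 : ∃ d₁ d₂ d₃ K : ℕ, 1 ≤ d₁ ∧ 1 ≤ d₂ ∧ 1 ≤ d₃ ∧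
      ∀ (σ σ₁ σ₂ : ℕ → ℕ), StrictMono σ → IsTimeConstructible σ →
        (∀ᶠ n in atTop, 2 * n * σ n < 2 ^ n) → IsTimeConstructible σ₁ → IsTimeConstructible σ₂ →
        (∀ n, σ n ^ (2 * d₂) ≤ σ₂ n) → (∀ n, σ (σ₂ n) ≤ σ₁ n) → (∀ n, σ n ^ (2 * d₁ + 1) ≤ σ₁ n) →
        ∃ (L₁ Ref : Language Bool) (adv : ℕ → List Bool), Ref ∈ DTIME (fun n => n ^ K) ∧
          (∀ n, (adv n).length ≤ 2 * Nat.log 2 (σ₂ n) + 2) ∧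
          (∀ x : List Bool,
            (x ∈ L₁ → ∃ z : List Bool, z.length = σ₁ x.length ^ 2 * σ₂ x.length ^ d₃ ∧
              (2 / 3 : ℝ) ≤ uniformProb (σ₁ x.length ^ 2 * σ₂ x.length ^ d₃)
                {r | boolPair (boolPair (boolPair x (adv x.length)) z) r ∈ Ref}) ∧
            (x ∉ L₁ → ∀ z : List Bool, z.length = σ₁ x.length ^ 2 * σ₂ x.length ^ d₃ →
              uniformProb (σ₁ x.length ^ 2 * σ₂ x.length ^ d₃)
                {r | boolPair (boolPair (boolPair x (adv x.length)) z) r ∈ Ref} ≤ 1 / 3)) ∧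
          ∀ᶠ n in atTop, σ n < L₁.circuitSize n ∨ σ (σ₂ n) < L₁.circuitSize (σ₂ n))
    (h21 : ∃ g : ℕ, 1 ≤ g ∧ ∃ F : List Bool → List Bool, F ∈ FP ∧
      ∀ (m u : ℕ) (f : (Fin m → Bool) → Bool), 1 ≤ u → u ^ g ≤ circuitSizeOver B2 f →
        IsSizePseudorandom (tableGenerator F f (g * m) u))
    (hN : ∀ (γ K : ℕ) (F : List Bool → List Bool), F ∈ FP → ∃ E : ℕ, 1 ≤ E ∧
      ∀ (Ref : Language Bool), Ref ∈ DTIME (fun n => n ^ K) → ∀ (CNb : ℕ) (t : ℕ → ℕ),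
        IsTimeConstructible t → Monotone t → ∀ (mv : ℕ → ℕ), IsTimeConstructible mv → Monotone mv →
        ∀ C₀ : ℕ, (∀ n, mv n ≤ t n + C₀) → ∀ (L : Language Bool) (V : NVerifier t L),
          simLang t V Ref F γ mv (fun ℓ a => CNb * (ℓ + a + mv ℓ + 2) ^ (2 * K + 2) + 7)
            (fun N => 2 * bound t V N + mv N + 2) ∈ NTIME (fun n => t n ^ E)) :
    MurrayWilliams2018_lemma_4_1_ae := by
  classical
  obtain ⟨d₁, d₂, d₃, K, hd₁, hd₂, hd₃, H31⟩ := h31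
  obtain ⟨gU, -, F, hF, hPRG⟩ := h21
  obtain ⟨E, hE1, HN⟩ := hN gU K F hF
  set d' : ℕ := 2 * d₂ + 2 * d₁ + d₃ + 3 with hd'
  set e : ℕ := max E (2 * d' + 12) with hedef
  have he : 2 * d' + 12 ≤ e := le_max_right _ _
  have hEe : E ≤ e := le_max_left _ _
  have he1 : 1 ≤ e := by omega
  have hd1 : 1 ≤ d' := by omega
  have hde : d' ≤ e := by omega
  have hd3 : d₃ + 2 ≤ d' := by omega
  refine ⟨e, (K + 1) * gU + 1, 1, he1, by omega, le_rfl, ?_⟩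
  intro s t hs hsc htc htm ha hb hc
  by_contra hcontra
  -- the verifier with bad inputs
  obtain ⟨L, -, V, hbad⟩ := exists_verifier_bad_prefix hcontra
  -- Thm. 3.1 on `s'`, `s₁'`, `s₂'`
  obtain ⟨hT', hT₂, hT₁⟩ := (show IsTimeConstructible (fun n => s (e * n)) ∧
      IsTimeConstructible (fun n => s (e * n) ^ d') ∧
      IsTimeConstructible (fun n => s (e * (s (e * n) ^ d'))) from by
    have h1 : IsTimeConstructible fun n => s (e * n) := hsc.comp_mul_left he1
    have h2 : IsTimeConstructible fun n => s (e * n) ^ d' := h1.pow hd1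
    exact ⟨h1, h2, h2.comp h1⟩)
  have hsm' : StrictMono fun n => s (e * n) := fun a b hab =>
    hs (Nat.mul_lt_mul_of_pos_left hab (by omega))
  have hcsf : ∀ᶠ n in atTop, 2 * n * s (e * n) < 2 ^ n :=
    eventually_two_mul_mul_stretchBase_lt (by omega) ha
  have hi : ∀ n, s (e * n) ^ (2 * d₂) ≤ s (e * n) ^ d' := fun n =>
    pow_le_pow_right_of_one_le (by omega) (by omega)
  have hiii : ∀ n, s (e * n) ^ (2 * d₁ + 1) ≤ s (e * (s (e * n) ^ d')) := fun n =>
    (pow_le_pow_right_of_one_le (by omega) (show 2 * d₁ + 1 ≤ d' by omega)).trans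
      (le_sigma' hs he1 _)
  obtain ⟨L₁, Ref, adv, hR, hadv, hprom, hhard⟩ :=
    H31 (fun n => s (e * n)) (fun n => s (e * (s (e * n) ^ d'))) (fun n => s (e * n) ^ d')
      hsm' hT' hcsf hT₁ hT₂ hi (fun n => le_rfl) hiii
  -- Arthur's circuits, the constants
  obtain ⟨Cq, hCq⟩ := exists_arthur_circuits hR
  set CNb : ℕ := Cq * 8 ^ (2 * K + 1) + 1 with hCNb
  -- the move length: time constructible, monotone, `≤ t + C₀`
  set mv : ℕ → ℕ := fun n => s (e * (s (e * n) ^ d')) ^ 2 * (s (e * n) ^ d') ^ d₃ with hmv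
  have hmvTC : IsTimeConstructible mv := (hT₁.pow (by norm_num)).mul (hT₂.pow hd₃)
  have hmvmono : Monotone mv := by
    intro a b hab
    simp only [hmv]
    have h1 : s (e * a) ^ d' ≤ s (e * b) ^ d' :=
      Nat.pow_le_pow_left (hs.monotone (Nat.mul_le_mul_left e hab)) _
    have h2 : s (e * (s (e * a) ^ d')) ≤ s (e * (s (e * b) ^ d')) :=
      hs.monotone (Nat.mul_le_mul_left e h1)
    exact Nat.mul_le_mul (Nat.pow_le_pow_left h2 2) (Nat.pow_le_pow_left h1 _)
  have hmvt : ∀ᶠ n in atTop, mv n ≤ t n := by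
    filter_upwards [hb] with n hn
    have h1 : mv n ≤ stretch s e (stretch s e n) := mv_le_stretch_stretch hs he1 hd3 hde n
    have h2 : stretch s e (stretch s e n) ≤ (stretch s e)^[3] n := by
      simp only [Function.iterate_succ_apply', Function.iterate_zero_apply]
      exact id_le_stretch hs he1 _
    have h3 : (stretch s e)^[3] n ≤ t n := by simpa using hn
    exact h1.trans (h2.trans h3)
  obtain ⟨C₀, hC₀⟩ := exists_add_const_of_eventually_le hmvt
  -- the simulation language is in `NTIME (t ^ e)`
  have hsimE := HN Ref hR CNb t htc htm mv hmvTC hmvmono C₀ hC₀ L V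
  have hsim := NTIME_pow_mono htc hE1 hEe hsimE
  -- the contradiction
  exact false_of_components (d₃ := d₃) (K := K) (gU := gU) (CNb := CNb) (Cq := Cq) hs htm ha hc he hd3
    hde hPRG hadv (fun x hx => (hprom x).1 hx) (fun x hx => (hprom x).2 hx) hhard hCq hCNb V hbad
    hsim

end MWSim

end Literature.Computability.Complexity

end
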